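import Literature.NumberTheory.GaloisCohomology.Howard2004.TransverseConditionRingClassKernelProofs
import Literature.NumberTheory.GaloisCohomology.Howard2004.FiniteSingularEvaluationLinearProofs
import Literature.NumberTheory.GaloisCohomology.Howard2004.TransverseUnramifiedDisjointProofs
import Mathlib.LinearAlgebra.Projection
import HarnessLib

/-!
# `H¹(K_λ, T) = H¹_f ⊕ H¹_tr` when `Gal(K[ℓ]_λ/K_λ)` is cyclic on a tame generator — the complement half of
# Howard 2004 Prop. 1.1.9 from the structure of the local ring-class extension (proofs file)

Topic `NumberTheory/GaloisCohomology/Howard2004` (sequel to `TransverseUnramifiedDisjointProofs` (disjointness),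
`TransverseConditionRingClassKernelProofs` (`H¹_tr = ker res_{Γ_{K_λ} ∩ Γ_{K[ℓ]}}` for `p`-primary `T`),
`FiniteSingularEvaluationLinearProofs` (`H¹_s ≃ₗ[R] T`)).  THEOREMS ONLY: no definition, no named fact, no
instance, no `sorry`.

B. Howard, *The Heegner point Kolyvagin system*, Compositio Math. 140 (2004), Prop. 1.1.9 (= arXiv:1202.6340
Prop. 2.1.9, p. 6 L17–25): «`H¹(K_λ, T) = H¹_f(K_λ, T) ⊕ H¹_tr(K_λ, T)`», both «free rank two `R`-modules»
(§1.5, p. 9 L105–108), for `T` with trivial `Γ_{K_λ}`-action at a degree-two prime `λ ∣ ℓ`, where `H¹_tr` is cut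
out by `L ⊆ K[ℓ]_λ`, «a maximal totally tamely ramified abelian `p`-extension of `K_λ`» (§1.2, p. 6 L84–95).

WHAT IS PROVED.  The COMPLEMENT half `H¹_f + H¹_tr = H¹` from the structure of the local extension cut out by an
open normal subgroup `Λ ≤ Γ_F` (for Howard: `Λ = Γ_{K_λ} ∩ Γ_{K[ℓ]}`), stated as two hypotheses in the tree's
currency — **`Γ_F/Λ` is cyclic, generated by (the image of) a tame generator `σ₀` of the inertia group**
(`hcyc : ∀ σ, ∃ j, (σ₀^j)⁻¹ σ ∈ Λ`; for Howard: «`K[ℓ]_λ/K_λ` totally TAMELY ramified», refining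
`InertRingClassTotallyRamifiedProofs`) and **every exponent `d` with `σ₀^d ∈ Λ` kills `T`** (`hkill`; for Howard:
`#Gal(K[ℓ]_λ/K_λ) = (ℓ+1)/u_K` kills the `p`-primary `T` when `(ℓ + 1)·T = 0`, `p ∤ u_K`):
* §1 (any non-archimedean local field `F`, trivial-action finite `N`):
  **`exists_resSubgroup_eq_zero_and_evalClass_eq`** — every `t ∈ N` is the value at `σ₀` of a class dying on `Λ`
  (the class of `σ ↦ j_σ • t`, `σ ∈ σ₀^{j_σ} Λ`); **`codisjoint_unramifiedSubgroup_ker_resSubgroup`** —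
  `H¹_ur(F, N) ⊔ ker(H¹(F, N) → H¹(Λ, N)) = ⊤` (subtract such a class and land in `H¹_ur` by the injectivity of
  the singular evaluation, `(q_F − 1)·N = 0`); **`isCompl_unramifiedSubgroup_ker_resSubgroup`** with the
  disjointness of `TransverseUnramifiedDisjointProofs` (`htot` follows from `hcyc`, `σ₀` being an inertia element).
* §2 (Howard's `λ`, `p`-primary `T`): **`isCompl_unramifiedSubgroup_transverseCondition_of_cyclic`** —
  `IsCompl (H¹_f(K_λ, T)) (transverseCondition p T ℓ jbar λ)`; the `R`-submodule form
  **`isCompl_submodule_of_isCompl`** (`IsCompl Vf Vtr` for `R`-submodules with these underlying groups — the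
  input `hc` of `Literature/Algebra/Module/LagrangianSubmodulesSplitPairing`) and
  **`nonempty_linearEquiv_of_isCompl_unramifiedSubmodule`** (`Vtr ≃ₗ[R] T` by the singular evaluation, whence the
  input `etr` with H.0: `H¹_tr` «free of rank two»).
NOT here: the discharge of `hcyc`/`hkill` at an inert prime of an imaginary quadratic field (the order and a
generator of `Gal(K[ℓ]_λ/K_λ) ≅ Gal(K[ℓ]/K[1])`, Gross 1991 §3), for which `InertRingClassTotallyRamifiedProofs`
already gives `Γ_{K_λ} = I_{K_λ} · Λ`.

Cell `pub/bsd-print-x9`, G87 = Howard 2004 Thm. 1.6.1 (print leaf `stub_h161` of stmt-BirchSwinnertonDyer-22642);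
seat `bsd-line-x9-p1-w3` g14, brick (SPLIT-CYC).  BSD is not proved by any of this.

References: [Howard2004HeegnerKolyvagin] Prop. 1.1.7, Prop. 1.1.9, §1.2, §1.5 (arXiv:1202.6340 pp. 5–6, 9);
[MazurRubinMemoirs2004] Lemma 1.2.1, Def. 1.1.6 (iv); [SerreInventiones1972] §1.3 (tame characters).
-/

set_option autoImplicit false

noncomputable section

open Function NumberField IsDedekindDomain Field Topology
open scoped NumberField Pointwise

namespace Literature.NumberTheory.GaloisCohomology.Howard2004

open Literature.NumberTheory.GaloisRepresentations
open Literature.NumberTheory.GaloisRepresentations.DiscreteGaloisModule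
open Literature.NumberTheory.GaloisRepresentations.IsNonarchimedeanLocalField

/-! ## §1 Local: a class dying on `Λ` with prescribed value at a generator; the complement -/

section Local

variable {F : Type} [Field F] [ValuativeRel F] [TopologicalSpace F] [IsNonarchimedeanLocalField F]
  {N : Type} [AddCommGroup N] [TopologicalSpace N] [DiscreteTopology N]

omit [ValuativeRel F] [TopologicalSpace F] [IsNonarchimedeanLocalField F] in
/-- Group-theoretic plumbing: if `(σ₀^a)⁻¹σ ∈ Λ` and `(σ₀^b)⁻¹σ ∈ Λ` with `a ≤ b` then `σ₀^(b-a) ∈ Λ`.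
[cite: SerreInventiones1972, §1.3 (tame characters)] -/
private theorem pow_sub_mem_of_inv_pow_mul_mem {Λ : Subgroup (absoluteGaloisGroup F)}
    {σ₀ σ : absoluteGaloisGroup F} {a b : ℕ} (hab : a ≤ b) (ha : (σ₀ ^ a)⁻¹ * σ ∈ Λ)
    (hb : (σ₀ ^ b)⁻¹ * σ ∈ Λ) : σ₀ ^ (b - a) ∈ Λ := by
  have h := Λ.mul_mem ha (Λ.inv_mem hb)
  have key : ∀ d : ℕ, (σ₀ ^ a)⁻¹ * σ₀ ^ (a + d) = σ₀ ^ d := fun d => by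
    rw [pow_add, inv_mul_cancel_left]
  have heq : (σ₀ ^ a)⁻¹ * σ * ((σ₀ ^ b)⁻¹ * σ)⁻¹ = σ₀ ^ (b - a) := by
    rw [mul_inv_rev, inv_inv, mul_assoc, mul_inv_cancel_left, ← key (b - a), Nat.add_sub_cancel' hab]
  rwa [heq] at h

omit [ValuativeRel F] [TopologicalSpace F] [IsNonarchimedeanLocalField F] in
/-- **Every `t` is the value at `σ₀` of a class dying on `Λ`**, when `Γ_F/Λ` is cyclic generated by the image of
`σ₀` (`hcyc`) and every exponent `d` with `σ₀^d ∈ Λ` kills `t` (`hkill`); `Λ` an open normal subgroup, the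
`Γ_F`-action on `N` trivial.  The class is that of the continuous homomorphism `σ ↦ j • t` for `σ ∈ σ₀^j Λ`
(well defined by `hkill`, locally constant since `Λ` is open).
[cite: Howard2004HeegnerKolyvagin, Prop. 1.1.9 (arXiv:1202.6340 Prop. 2.1.9, p. 6 L17–25)] -/
theorem exists_resSubgroup_eq_zero_and_evalClass_eq (ρ : DiscreteGaloisModule F N)
    (htriv : ∀ (σ : absoluteGaloisGroup F) (x : N), ρ σ x = x) (Λ : Subgroup (absoluteGaloisGroup F))
    [hΛn : Λ.Normal] (hΛ : IsOpen (Λ : Set (absoluteGaloisGroup F))) (σ₀ : absoluteGaloisGroup F)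
    (hcyc : ∀ σ : absoluteGaloisGroup F, ∃ j : ℕ, (σ₀ ^ j)⁻¹ * σ ∈ Λ) (t : N)
    (hkill : ∀ d : ℕ, σ₀ ^ d ∈ Λ → d • t = 0) :
    ∃ c : galoisCohomology ρ 1, resSubgroup ρ.toTopRep Λ 1 c = 0 ∧ evalClass ρ htriv σ₀ c = t := by
  classical
  choose j hj using hcyc
  -- two admissible exponents give the same multiple of `t`
  have hwd : ∀ (σ : absoluteGaloisGroup F) (a b : ℕ), (σ₀ ^ a)⁻¹ * σ ∈ Λ → (σ₀ ^ b)⁻¹ * σ ∈ Λ →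
      a • t = b • t := by
    suffices h : ∀ (σ : absoluteGaloisGroup F) (a b : ℕ), a ≤ b → (σ₀ ^ a)⁻¹ * σ ∈ Λ →
        (σ₀ ^ b)⁻¹ * σ ∈ Λ → a • t = b • t by
      intro σ a b ha hb
      rcases le_total a b with hab | hab
      · exact h σ a b hab ha hb
      · exact (h σ b a hab hb ha).symm
    intro σ a b hab ha hb
    have hk := hkill (b - a) (pow_sub_mem_of_inv_pow_mul_mem hab ha hb)
    calc a • t = a • t + (b - a) • t := by rw [hk, add_zero]
      _ = b • t := by rw [← add_nsmul, Nat.add_sub_cancel' hab]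
  -- the function `f σ = j_σ • t` and its value on admissible exponents
  set f : absoluteGaloisGroup F → N := fun σ => j σ • t with hf_def
  have hfval : ∀ (σ : absoluteGaloisGroup F) (a : ℕ), (σ₀ ^ a)⁻¹ * σ ∈ Λ → f σ = a • t :=
    fun σ a ha => hwd σ (j σ) a (hj σ) ha
  -- additivity
  have hfmul : ∀ σ τ : absoluteGaloisGroup F, f (σ * τ) = f σ + f τ := by
    intro σ τ
    have hmem : (σ₀ ^ (j σ + j τ))⁻¹ * (σ * τ) ∈ Λ := by
      have hconj : (σ₀ ^ j τ)⁻¹ * ((σ₀ ^ j σ)⁻¹ * σ) * (σ₀ ^ j τ)⁻¹⁻¹ ∈ Λ := hΛn.conj_mem _ (hj σ) _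
      have h := Λ.mul_mem hconj (hj τ)
      have heq : (σ₀ ^ j τ)⁻¹ * ((σ₀ ^ j σ)⁻¹ * σ) * (σ₀ ^ j τ)⁻¹⁻¹ * ((σ₀ ^ j τ)⁻¹ * τ) =
          (σ₀ ^ (j σ + j τ))⁻¹ * (σ * τ) := by
        rw [pow_add]; group
      rwa [heq] at h
    rw [hfval (σ * τ) (j σ + j τ) hmem, add_nsmul]
  -- vanishing on `Λ`, value at `σ₀`
  have hfΛ : ∀ n ∈ Λ, f n = 0 := fun n hn => by
    rw [hfval n 0 (by simpa using hn), zero_smul]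
  have hfσ₀ : f σ₀ = t := by
    rw [hfval σ₀ 1 (by simp [Λ.one_mem]), one_smul]
  -- continuity (locally constant: constant on the open cosets `σΛ`)
  have hfcont : Continuous f := by
    refine (IsLocallyConstant.iff_exists_open f).2 (fun σ => ?_) |>.continuous
    refine ⟨σ • (Λ : Set (absoluteGaloisGroup F)), hΛ.smul σ, ?_, fun σ' hσ' => ?_⟩
    · exact ⟨1, Λ.one_mem, by simp⟩
    · obtain ⟨n, hn, rfl⟩ := Set.mem_smul_set.1 hσ'
      have hmem : (σ₀ ^ j σ)⁻¹ * (σ • n) ∈ Λ := by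
        rw [smul_eq_mul, ← mul_assoc]
        exact Λ.mul_mem (hj σ) hn
      exact hfval (σ • n) (j σ) hmem
  -- the cocycle and its class
  let z : contOneCocycles ρ.toTopRep :=
    ⟨⟨f, hfcont⟩, fun g h => by
      change f (g * h) = f g + ρ.toTopRep.ρ g (f h)
      rw [ContinuousRep.toTopRep_ρ_apply, htriv, hfmul]⟩
  refine ⟨oneCocycleClass ρ.toTopRep z, ?_, ?_⟩
  · exact (resSubgroup_oneCocycleClass_eq_zero_iff ρ.toTopRep Λ z).2
      ⟨0, fun n hn => by rw [map_zero, sub_zero]; exact hfΛ n hn⟩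
  · rw [evalClass_oneCocycleClass]
    exact hfσ₀

/-- **`H¹_ur(F, N) ⊔ ker (H¹(F, N) → H¹(Λ, N)) = ⊤`** (trivial action, `N` finite with `(q_F − 1)·N = 0`,
`σ₀ ∈ I_F` a tame generator, `Γ_F/Λ` cyclic on `σ₀`, exponents of `σ₀` in `Λ` killing `N`): for any class
`x`, subtract the class of §1 with the same value at `σ₀`; the difference has singular evaluation `0`, hence is
unramified (`singularEval_injective`).
[cite: Howard2004HeegnerKolyvagin, Prop. 1.1.7 / Prop. 1.1.9 (arXiv:1202.6340 p. 5 L129–141, p. 6 L17–25)]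
[cite: MazurRubinMemoirs2004, Lemma 1.2.1] -/
theorem codisjoint_unramifiedSubgroup_ker_resSubgroup (ρ : DiscreteGaloisModule F N)
    (htriv : ∀ (σ : absoluteGaloisGroup F) (x : N), ρ σ x = x) (Λ : Subgroup (absoluteGaloisGroup F))
    [Λ.Normal] (hΛ : IsOpen (Λ : Set (absoluteGaloisGroup F))) {σ₀ : absInertia F}
    (hσ₀ : IsTameGenerator σ₀) (hq : ∀ x : N, (residueFieldCard F - 1) • x = 0)
    (hcyc : ∀ σ : absoluteGaloisGroup F, ∃ j : ℕ, ((σ₀ : absoluteGaloisGroup F) ^ j)⁻¹ * σ ∈ Λ)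
    (hkill : ∀ d : ℕ, (σ₀ : absoluteGaloisGroup F) ^ d ∈ Λ → ∀ x : N, d • x = 0) :
    Codisjoint (unramifiedSubgroup ρ 1) (resSubgroup ρ.toTopRep Λ 1).hom.toLinearMap.toAddMonoidHom.ker := by
  rw [codisjoint_iff, eq_top_iff]
  intro x _
  obtain ⟨c, hcΛ, hct⟩ := exists_resSubgroup_eq_zero_and_evalClass_eq ρ htriv Λ hΛ (σ₀ : absoluteGaloisGroup F)
    hcyc (evalClass ρ htriv (σ₀ : absoluteGaloisGroup F) x) (fun d hd => hkill d hd _)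
  have hur : x - c ∈ unramifiedSubgroup ρ 1 := by
    rw [← singularMap_eq_zero_iff]
    apply singularEval_injective ρ htriv hσ₀ hq
    rw [map_zero, singularEval_singularMap, map_sub, hct, sub_self]
  have hx : x = (x - c) + c := by abel
  rw [hx]
  exact AddSubgroup.add_mem_sup hur hcΛ

/-- **`H¹(F, N) = H¹_ur(F, N) ⊕ ker (H¹(F, N) → H¹(Λ, N))`** under the hypotheses of
`codisjoint_unramifiedSubgroup_ker_resSubgroup` (disjointness: `TransverseUnramifiedDisjointProofs`, the
totally-ramified hypothesis `Γ_F = I_F · Λ` following from `hcyc` since `σ₀ ∈ I_F`).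
[cite: Howard2004HeegnerKolyvagin, Prop. 1.1.9 (arXiv:1202.6340 Prop. 2.1.9, p. 6 L17–25)] -/
theorem isCompl_unramifiedSubgroup_ker_resSubgroup (ρ : DiscreteGaloisModule F N)
    (htriv : ∀ (σ : absoluteGaloisGroup F) (x : N), ρ σ x = x) (Λ : Subgroup (absoluteGaloisGroup F))
    [Λ.Normal] (hΛ : IsOpen (Λ : Set (absoluteGaloisGroup F))) {σ₀ : absInertia F}
    (hσ₀ : IsTameGenerator σ₀) (hq : ∀ x : N, (residueFieldCard F - 1) • x = 0)
    (hcyc : ∀ σ : absoluteGaloisGroup F, ∃ j : ℕ, ((σ₀ : absoluteGaloisGroup F) ^ j)⁻¹ * σ ∈ Λ)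
    (hkill : ∀ d : ℕ, (σ₀ : absoluteGaloisGroup F) ^ d ∈ Λ → ∀ x : N, d • x = 0) :
    IsCompl (unramifiedSubgroup ρ 1) (resSubgroup ρ.toTopRep Λ 1).hom.toLinearMap.toAddMonoidHom.ker := by
  refine ⟨?_, codisjoint_unramifiedSubgroup_ker_resSubgroup ρ htriv Λ hΛ hσ₀ hq hcyc hkill⟩
  refine disjoint_unramifiedSubgroup_ker_resSubgroup ρ Λ htriv fun σ => ?_
  obtain ⟨j, hjσ⟩ := hcyc σ
  exact ⟨(σ₀ : absoluteGaloisGroup F) ^ j, Subgroup.pow_mem _ σ₀.2 j, hjσ⟩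

end Local

/-! ## §2 Howard's `H¹(K_λ, T) = H¹_f ⊕ H¹_tr`, and the `R`-module readings -/

section Howard

variable {K : Type} [Field K] [NumberField K] {M : Type} [AddCommGroup M] [TopologicalSpace M]
  [DiscreteTopology M] (p : ℕ) [Fact p.Prime]

/-- **Prop. 1.1.9 at `λ`, from the cyclic structure of `Gal(K[ℓ]_λ/K_λ)`**: for a finite `p`-primary `T` with
trivial `Γ_{K_λ}`-action and `(q_λ − 1)·T = 0`, a tame generator `σ₀ ∈ I_{K_λ}` with
`Γ_{K_λ} = ⋃_j σ₀^j · (Γ_{K_λ} ∩ Γ_{K[ℓ]})` and every exponent `d` with `σ₀^d ∈ Γ_{K[ℓ]}` killing `T`: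
`IsCompl (H¹_f(K_λ, T)) (H¹_tr(K_λ, T))`.
[cite: Howard2004HeegnerKolyvagin, Prop. 1.1.9 and §1.2 (arXiv:1202.6340 p. 6 L17–25, L84–95)] -/
theorem isCompl_unramifiedSubgroup_transverseCondition_of_cyclic [Finite M] (ρ : DiscreteGaloisModule K M)
    (ℓ : ℕ) (jbar : AlgebraicClosure K →+* ℂ) (v : HeightOneSpectrum (𝓞 K))
    (htriv : ∀ (g : absoluteGaloisGroup (v.adicCompletion K)) (x : M), GaloisRep.toLocal v ρ g x = x)
    (hp : ∀ x : M, ∃ n : ℕ, p ^ n • x = 0) [(localRingClassSubgroup ℓ jbar v).Normal]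
    (hΛ : IsOpen (localRingClassSubgroup ℓ jbar v : Set (absoluteGaloisGroup (v.adicCompletion K))))
    {σ₀ : absInertia (v.adicCompletion K)} (hσ₀ : IsTameGenerator σ₀)
    (hq : ∀ x : M, (residueFieldCard (v.adicCompletion K) - 1) • x = 0)
    (hcyc : ∀ σ : absoluteGaloisGroup (v.adicCompletion K),
      ∃ j : ℕ, ((σ₀ : absoluteGaloisGroup (v.adicCompletion K)) ^ j)⁻¹ * σ ∈ localRingClassSubgroup ℓ jbar v)
    (hkill : ∀ d : ℕ, (σ₀ : absoluteGaloisGroup (v.adicCompletion K)) ^ d ∈ localRingClassSubgroup ℓ jbar v →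
      ∀ x : M, d • x = 0) :
    IsCompl (DiscreteGaloisModule.unramifiedSubgroup (GaloisRep.toLocal v ρ) 1)
      (transverseCondition p ρ ℓ jbar v) := by
  rw [transverseCondition_eq_ker_resSubgroup_localRingClassSubgroup p ρ ℓ jbar v htriv hp]
  exact isCompl_unramifiedSubgroup_ker_resSubgroup (GaloisRep.toLocal v ρ) htriv
    (localRingClassSubgroup ℓ jbar v) hΛ hσ₀ hq hcyc hkill

/-! ### The `R`-module readings (`hc`, `etr` of the Lagrangian algebra) -/

variable {R : Type} [CommRing R] [Module R M]

/-- **`IsCompl` for `R`-submodules from `IsCompl` for the underlying subgroups**: if `Vf`, `Vtr` are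
`R`-submodules (functorial structure `moduleH1`) whose underlying groups are complementary additive subgroups,
they are complementary submodules (the input `hc` of `LagrangianSubmodulesSplitPairing`).
[cite: Howard2004HeegnerKolyvagin, Prop. 1.1.9 (arXiv:1202.6340 Prop. 2.1.9, p. 6 L17–25)] -/
theorem isCompl_submodule_of_isCompl {V : Type*} [AddCommGroup V] [Module R V] (Vf Vtr : Submodule R V)
    (h : IsCompl Vf.toAddSubgroup Vtr.toAddSubgroup) : IsCompl Vf Vtr := by
  refine ⟨?_, ?_⟩
  · rw [disjoint_iff, eq_bot_iff]
    intro x hx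
    have hx' : x ∈ Vf.toAddSubgroup ⊓ Vtr.toAddSubgroup := hx
    rw [h.1.eq_bot] at hx'
    exact hx'
  · rw [codisjoint_iff, eq_top_iff]
    intro x _
    have hx' : x ∈ Vf.toAddSubgroup ⊔ Vtr.toAddSubgroup := by rw [h.2.eq_top]; trivial
    obtain ⟨a, ha, b, hb, rfl⟩ := AddSubgroup.mem_sup.1 hx'
    exact Submodule.add_mem_sup ha hb

/-- **`Vtr ≃ₗ[R] T` for a complement `Vtr` of the unramified submodule** (trivial action, `T` finite,
`(q − 1)·T = 0`, `σ₀` a tame generator): `Vtr ≅ H¹/H¹_ur = H¹_s ≅ T` (`Submodule.quotientEquivOfIsCompl` and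
the `R`-linear singular evaluation) — with H.0 (`T ≅ R_k²`) this is «`H¹_tr(K_λ, T)` is free of rank two», the
input `etr` of `LagrangianSubmodulesSplitPairing`.
[cite: Howard2004HeegnerKolyvagin, Prop. 1.1.7 / Prop. 1.1.9 (arXiv:1202.6340 p. 5 L138–141, p. 6 L17–25)] -/
theorem nonempty_linearEquiv_of_isCompl_unramifiedSubmodule {F : Type} [Field F] [ValuativeRel F]
    [TopologicalSpace F] [IsNonarchimedeanLocalField F] {N : Type} [AddCommGroup N] [TopologicalSpace N]
    [DiscreteTopology N] [Module R N] [Finite N] (ρ : DiscreteGaloisModule F N)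
    (htriv : ∀ (σ : absoluteGaloisGroup F) (x : N), ρ σ x = x) (hρ : ρ.IsScalarLinear R)
    {σ₀ : absInertia F} (hσ₀ : IsTameGenerator σ₀) (hq : ∀ x : N, (residueFieldCard F - 1) • x = 0) :
    letI := galoisCohomology.moduleH1 ρ hρ
    ∀ Vtr : Submodule R (galoisCohomology ρ 1), IsCompl (ρ.unramifiedSubmodule hρ) Vtr →
      Nonempty (↥Vtr ≃ₗ[R] N) := by
  letI := galoisCohomology.moduleH1 ρ hρ
  intro Vtr hc
  obtain ⟨e, -⟩ := nonempty_singularQuotient_linearEquiv ρ htriv hρ hσ₀ hq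
  letI := ρ.moduleSingularQuotient hρ
  exact ⟨(Submodule.quotientEquivOfIsCompl _ Vtr hc).symm.trans e⟩

end Howard

end Literature.NumberTheory.GaloisCohomology.Howard2004

end
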